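import Literature.AlgebraicGeometry.HodgeTheory.VHSDataHodgeLocusOverCurve
import Literature.AlgebraicGeometry.HodgeTheory.VHSDataApproximateHodgeClassesNearPuncture
import Literature.AlgebraicGeometry.Motives.HodgeStructureHodgeMetricContinuity
import Mathlib.Analysis.Convex.PathConnected
import Mathlib.Analysis.Normed.Module.Convex
import Mathlib.Topology.OpenPartialHomeomorph.Basic
import HarnessLib

/-!
# The interior period chart of a polarized `ℤ`-variation from a HOLOMORPHIC LIFT of the period map: the Hodge metrics of nearby fibres are
# uniformly comparable (continuity of the Hodge metric on `D`), hence the interior dichotomy of the Hodge locus and Cattani–Deligne–Kaplan's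
# Theorem 1.1 over a curve with the comparison hypothesis REMOVED

Topic `Literature/AlgebraicGeometry/HodgeTheory` (namespace `Literature.AlgebraicGeometry.Motives.VHSData`), the sequel of
`HodgeTheory/VHSDataHodgeLocusInteriorChart.lean` (interior dichotomy of `hodgeLocusOfNormLe D p K` in a chart, ASSUMING a uniform comparison
`κ‖1 ⊗ e_c(x)‖₀ ≤ ‖1 ⊗ x‖_{ρ(c)}` of the fibres' Hodge norms with a reference Hodge norm) and `HodgeTheory/VHSDataHodgeLocusOverCurve.lean` (CDK
Thm. 1.1 for `r = 1`), over `Motives/HodgeStructureHodgeMetricContinuity.lean` (the Hodge metric is continuous in the point of the period domain: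
along `u_s → 1`, `(1 − ε)‖x‖_F ≤ ‖x‖_{u_s·F} ≤ (1 + ε)‖x‖_F` eventually — `eventually_exists_hodgeNorm_mem_Icc`; `hodgeNorm_congr`) and
`Motives/HodgeStructureHodgeNormTransport.lean` (the Hodge norm read through a chart).  THEOREMS ONLY (no definition, no named fact, no instance;
D-0026 net debt `0`).

PRINTED SOURCES, VERBATIM.  E. Cattani, P. Deligne, A. Kaplan, *On the locus of Hodge classes*, J. AMS 8 (1995), §1 (p. 484): «the hermitian form
`h(u, v) = Q(Cu, v̄)` is positive definite … For `u` a real element of type `(0, 0)`, `h(u, u) = Q(u, u)`. … locally on `S`, `S^{(K)}` is a finite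
disjoint sum of closed analytic subspaces»; 2.1 (p. 486): «This Hodge metric is, generally, not flat.»  E. Cattani, A. Kaplan, W. Schmid,
*Variations of polarized Hodge structure: asymptotics and monodromy* (LNM 1246, 1987), §3, proof of Cor. (3.7) (p. 22): «`S(C_{e·φ̃}·, ·̄) ∼
S(C_{F̂₀}·, ·̄)` on the required region» (Hodge metrics at nearby points of `D` are uniformly quasi-isometric).  W. Schmid, *Variation of Hodge
structure* (1973), §3: the period map of a VHS over a simply connected base lifts holomorphically to `Ď = G_ℂ/B` (cite only).

THE HOLOMORPHIC-LIFT CHART (hypotheses; for `D` underlying an honest polarized VHS they are furnished by a simply connected coordinate disc, the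
flat trivialization over it and a local holomorphic section of `G_ℂ → Ď` through the period map).  `ψ : OpenPartialHomeomorph S ℂ` with `x` in its
domain, `c₀ = ψ(x)`; for `c ∈ ψ.target`: `e c : V_{ψ⁻¹(c)} ≃ V` carrying `Q_{ψ⁻¹(c)}` to `Q₀ = P₀.form` ((`H₀`, `P₀`) a reference polarized Hodge
structure of weight `k = p + p` on the finite-dimensional `V`), `V_ℤ` ONTO the finitely generated `Λ`, and EVERY step of the Hodge flag `F^q_{ψ⁻¹(c)}`
to `g(c)·F₀^q`, where `g(c)`, `h(c) = g(c)⁻¹` are endomorphisms of `V_ℂ`, the matrix coefficients of `h` are holomorphic on the target and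
`g(c) → 1` weakly as `c → c₀` (e.g. `g` continuous with `g(c₀) = 1`).
* §1 `Submodule.comap_eq_map_of_leftInverse_rightInverse` — `h⁻¹F = gF` for `g = h⁻¹` (the two readings of the transported flag).
* §2 `form_baseChange_lift_apply_eq_zero` — the flag `g(c)·F₀^•` satisfies the FIRST bilinear relation for `Q₀` (it is the flag of the fibre's
  polarized Hodge structure read in the chart).
* §3 **`eventually_hodgeNorm_fiber_mem_Icc_of_lift`** — **continuity of the Hodge metric along the family**: for every `ε > 0`, for `c` near
  `c₀`, `(1 − ε)‖1 ⊗ e_c(x)‖₀ ≤ ‖1 ⊗ x‖_{ψ⁻¹(c)} ≤ (1 + ε)‖1 ⊗ e_c(x)‖₀` for all `x ∈ V_{ψ⁻¹(c)}` («`S(C_{e·φ̃}·,·̄) ∼ S(C_{F̂₀}·,·̄)`»; «this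
  Hodge metric is, generally, not flat» — but it is continuous).
* §4 **`mem_nhds_or_eventually_not_mem_hodgeLocusOfNormLe_of_lift`** — the interior dichotomy at `x` (the Hodge locus of norm `≤ K` is a
  neighbourhood of `x` or punctured-avoided at `x`) for a holomorphic-lift chart, WITHOUT a comparison hypothesis: shrink the chart to a
  coordinate ball where §3 gives `κ = 1/2` and apply `VHSDataHodgeLocusInteriorChart`.
* §5 **`hodgeLocusOfNormLe_eq_univ_or_finite_of_lift`** — **CDK THEOREM 1.1 / COR. 1.2 (`r = 1`)** for `D : VHSData S k` on a preconnected `S`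
  with a compact core, holomorphic-lift charts at every point and unipotent puncture charts: `hodgeLocusOfNormLe D p K` is `S` or FINITE.

## References

* [CattaniDeligneKaplan1995] E. Cattani, P. Deligne, A. Kaplan, *On the locus of Hodge classes*, J. Amer. Math. Soc. 8 (1995) 483–506: §1
  (p. 484), Thm. 1.1, Cor. 1.2, 2.1 (p. 486), «Proof of 1.5 ⟹ 1.1» (p. 485).
* [CattaniKaplanSchmid1987] E. Cattani, A. Kaplan, W. Schmid, *Variations of polarized Hodge structure: asymptotics and monodromy*, LNM 1246
  (1987): §3, proof of Cor. (3.7) (p. 22).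
* [Schmid1973] W. Schmid, *Variation of Hodge structure: the singularities of the period mapping*, Invent. Math. 22 (1973): §2, §3 (cite only).
* [FritzscheGrauert2002] K. Fritzsche, H. Grauert, *From Holomorphic Functions to Complex Manifolds*, GTM 213 (2002), Ch. I §8.
-/

noncomputable section

open scoped TensorProduct ComplexOrder
open _root_.Topology _root_.Filter Set

namespace Literature.AlgebraicGeometry

open Module
open Motives Motives.MixedHodgeStructure Motives.HodgeStructure
open Motives.HodgeStructure (conj ofRat ofRat_apply conj_ofRat)
open HodgeTheory

universe u

/-! ## §1 The two readings of the transported flag: `h⁻¹F = gF` for `g = h⁻¹` -/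

/-- For mutually inverse endomorphisms `g`, `h` of a module and a submodule `F`: `h⁻¹(F) = g(F)`. [folklore] -/
private theorem comap_eq_map_of_inverse {R M : Type*} [CommSemiring R] [AddCommMonoid M] [Module R M] (F : Submodule R M) {g h : M →ₗ[R] M}
    (hgh : ∀ w, g (h w) = w) (hhg : ∀ w, h (g w) = w) : F.comap h = F.map g := by
  ext y
  rw [Submodule.mem_comap, Submodule.mem_map]
  constructor
  · intro hy
    exact ⟨h y, hy, hgh y⟩
  · rintro ⟨x, hx, rfl⟩
    rwa [hhg]

namespace Motives.VHSData

variable {S : Type} [TopologicalSpace S] {k : ℤ} (D : VHSData S k)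
variable {V : Type u} [AddCommGroup V] [Module ℚ V]

/-! ## §2 The flag `g(c)·F₀` satisfies the first bilinear relation for `Q₀` -/

/-- **In a chart carrying the whole Hodge flag of the fibre to `g·F₀^•` and the polarization to `Q₀`, the flag `g·F₀^•` satisfies the first
Hodge–Riemann bilinear relation for `Q₀`** (`Q₀(gF₀^p, gF₀^{k+1−p}) = 0`): it is the flag of the fibre's polarized Hodge structure read in the
chart. [cite: CattaniDeligneKaplan1995, §1 (p. 484) and 2.1 (pp. 485–486)] [cite: Schmid1973, §3 (cite only)] -/
theorem form_baseChange_lift_apply_eq_zero {s : S} (e : D.V.fiber s ≃ₗ[ℚ] V) (H₀ : HodgeStructure V k) (P₀ : H₀.Polarization)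
    (g : Module.End ℂ (ℂ ⊗[ℚ] V)) (hF : ∀ q : ℤ, ((D.hodge s).F q).map (e.toLinearMap.baseChange ℂ) = (H₀.F q).map g)
    (hQ : ∀ x y : D.V.fiber s, (D.form s).form x y = P₀.form (e x) (e y)) (p : ℤ) (x : ℂ ⊗[ℚ] V) (hx : x ∈ H₀.F p) (y : ℂ ⊗[ℚ] V)
    (hy : y ∈ H₀.F (k + 1 - p)) : P₀.form.baseChange ℂ (g x) (g y) = 0 := by
  have hform : ((D.form s).comapEquiv e.symm).form = P₀.form := D.comapEquiv_symm_form_eq_of_form_eq e hQ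
  have hflag : ∀ q, ((D.hodge s).comapEquiv e.symm).F q = (H₀.F q).map g := D.comapEquiv_symm_F_eq_of_map_F_eq e hF
  have h := ((D.form s).comapEquiv e.symm).form_apply_eq_zero p (g x) (by rw [hflag]; exact Submodule.mem_map_of_mem hx) (g y)
    (by rw [hflag]; exact Submodule.mem_map_of_mem hy)
  rwa [hform] at h

/-! ## §3 Continuity of the Hodge metric along the family, read in a holomorphic-lift chart -/

variable [FiniteDimensional ℚ V]

/-- **The Hodge metrics of the fibres near a point are uniformly quasi-isometric to the reference Hodge metric.**  Chart: `ρ : ℂ → S`, `U ⊆ ℂ`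
open with `c₀ ∈ U`; for `c ∈ U`, `e c : V_{ρ(c)} ≃ V` carrying the whole flag `F^•_{ρ(c)}` to `g(c)·F₀^•` and `Q_{ρ(c)}` to `Q₀ = P₀.form`, with
`g(c) → 1` weakly as `c → c₀`.  Then for every `ε > 0`, for all `c` near `c₀` and all `x ∈ V_{ρ(c)}`:
**`(1 − ε)‖1 ⊗ e_c(x)‖₀ ≤ ‖1 ⊗ x‖_{ρ(c)} ≤ (1 + ε)‖1 ⊗ e_c(x)‖₀`** («`S(C_{e·φ̃}·, ·̄) ∼ S(C_{F̂₀}·, ·̄)`»: the Hodge norm is a continuous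
function of the point of `D`, and `‖1 ⊗ x‖_{ρ(c)}` IS the Hodge norm of the polarized Hodge structure `(g(c)·F₀, Q₀)` at `1 ⊗ e_c(x)`).
[cite: CattaniKaplanSchmid1987, §3 proof of Cor. (3.7) (p. 22)] [cite: CattaniDeligneKaplan1995, 2.1 (p. 486)] -/
theorem eventually_hodgeNorm_fiber_mem_Icc_of_lift (ρ : ℂ → S) {U : Set ℂ} (hUo : IsOpen U) {c₀ : ℂ} (hc₀ : c₀ ∈ U)
    (e : ∀ c : ℂ, D.V.fiber (ρ c) ≃ₗ[ℚ] V) (H₀ : HodgeStructure V k) (P₀ : H₀.Polarization) (g : ℂ → Module.End ℂ (ℂ ⊗[ℚ] V))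
    (hg1 : ∀ (w : ℂ ⊗[ℚ] V) (φ : (ℂ ⊗[ℚ] V) →ₗ[ℂ] ℂ), Tendsto (fun c => φ (g c w)) (𝓝 c₀) (𝓝 (φ w)))
    (hF : ∀ c ∈ U, ∀ q : ℤ, ((D.hodge (ρ c)).F q).map ((e c).toLinearMap.baseChange ℂ) = (H₀.F q).map (g c))
    (hQ : ∀ c ∈ U, ∀ x y : D.V.fiber (ρ c), (D.form (ρ c)).form x y = P₀.form (e c x) (e c y)) {ε : ℝ} (hε : 0 < ε) :
    ∀ᶠ c in 𝓝 c₀, c ∈ U ∧ ∀ x : D.V.fiber (ρ c),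
      (1 - ε) * P₀.hodgeNorm (ofRat (e c x)) ≤ (D.form (ρ c)).hodgeNorm (ofRat x) ∧
        (D.form (ρ c)).hodgeNorm (ofRat x) ≤ (1 + ε) * P₀.hodgeNorm (ofRat (e c x)) := by
  have hU : ∀ᶠ c in 𝓝 c₀, c ∈ U := hUo.mem_nhds hc₀
  -- the first bilinear relation for `g(c)·F₀`, `c ∈ U`
  have hHR : ∀ᶠ c in 𝓝 c₀, ∀ p : ℤ, ∀ x ∈ H₀.F p, ∀ y ∈ H₀.F (k + 1 - p), P₀.form.baseChange ℂ (g c x) (g c y) = 0 := by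
    filter_upwards [hU] with c hc p x hx y hy
    exact D.form_baseChange_lift_apply_eq_zero (e c) H₀ P₀ (g c) (hF c hc) (hQ c hc) p x hx y hy
  filter_upwards [hU, P₀.eventually_exists_hodgeNorm_mem_Icc g hg1 hHR hε] with c hc ⟨H', P', hF', hform', hb⟩
  refine ⟨hc, fun x => ?_⟩
  -- `‖1 ⊗ x‖_{ρ(c)}` is the Hodge norm of the transported structure, whose flag is `g(c)·F₀` and whose form is `Q₀`: that of `(H′, P′)`
  have hflag : ∀ q, ((D.hodge (ρ c)).comapEquiv (e c).symm).F q = (H₀.F q).map (g c) := D.comapEquiv_symm_F_eq_of_map_F_eq (e c) (hF c hc)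
  have hform : ((D.form (ρ c)).comapEquiv (e c).symm).form = P₀.form := D.comapEquiv_symm_form_eq_of_form_eq (e c) (hQ c hc)
  have heq : (D.form (ρ c)).hodgeNorm (ofRat x) = P'.hodgeNorm (ofRat (e c x)) := by
    rw [← D.hodgeNorm_comapEquiv_symm_ofRat_equiv (e c) x]
    exact Polarization.hodgeNorm_congr _ P' (fun q => by rw [hflag, hF']) (by rw [hform, hform']) _
  rw [heq]
  exact hb _

/-! ## §4 The interior dichotomy at a point, for a holomorphic-lift chart -/

/-- Pull-back of a punctured-neighbourhood statement along a chart `ψ` at a point of its domain. [folklore] -/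
private theorem eventually_nhdsWithin_ne_of_chart' (ψ : OpenPartialHomeomorph S ℂ) {x : S} (hx : x ∈ ψ.source)
    {P : ℂ → Prop} (hP : ∀ᶠ c in 𝓝[≠] (ψ x), P c) : ∀ᶠ y in 𝓝[≠] x, y ∈ ψ.source ∧ P (ψ y) := by
  have h1 : ∀ᶠ y in 𝓝[≠] x, y ∈ ψ.source := mem_nhdsWithin_of_mem_nhds (ψ.open_source.mem_nhds hx)
  have h2 : Tendsto ψ (𝓝[≠] x) (𝓝 (ψ x)) := (ψ.continuousAt hx).tendsto.mono_left nhdsWithin_le_nhds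
  have h3 : Tendsto ψ (𝓝[≠] x) (𝓝[≠] (ψ x)) := by
    refine tendsto_nhdsWithin_iff.2 ⟨h2, ?_⟩
    filter_upwards [h1, self_mem_nhdsWithin] with y hy hyx
    exact fun heq => hyx (ψ.injOn hy hx heq)
  filter_upwards [h1, h3.eventually hP] with y hy hPy
  exact ⟨hy, hPy⟩

/-- **The interior dichotomy at `x` for a holomorphic-lift chart, no comparison hypothesis.**  `ψ : OpenPartialHomeomorph S ℂ` with `x ∈ ψ.source`;
for `c ∈ ψ.target`: `e c : V_{ψ⁻¹(c)} ≃ V` carrying every `F^q_{ψ⁻¹(c)}` to `g(c)·F₀^q`, `Q` to `Q₀`, `V_ℤ` ONTO the finitely generated `Λ`;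
`g(c)`, `h(c)` mutually inverse endomorphisms of `V_ℂ`, the matrix coefficients of `h` holomorphic on the target, `g(c) → 1` weakly as
`c → ψ(x)`.  Then **`hodgeLocusOfNormLe D p K` is a neighbourhood of `x`, or is avoided by a punctured neighbourhood of `x`**: on a coordinate ball
around `ψ(x)` the Hodge metrics are uniformly comparable (§3, `κ = 1/2`), so `VHSDataHodgeLocusInteriorChart` applies there («locally on `S`,
`S^{(K)}` is a finite disjoint sum of closed analytic subspaces», one variable).
[cite: CattaniDeligneKaplan1995, §1 (p. 484)] [cite: CattaniKaplanSchmid1987, §3 proof of Cor. (3.7) (p. 22)] [cite: FritzscheGrauert2002, Ch. I §8] -/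
theorem mem_nhds_or_eventually_not_mem_hodgeLocusOfNormLe_of_lift {p : ℤ} (hpk : p + p = k) (ψ : OpenPartialHomeomorph S ℂ) {x : S}
    (hx : x ∈ ψ.source) (e : ∀ c : ℂ, D.V.fiber (ψ.symm c) ≃ₗ[ℚ] V) (H₀ : HodgeStructure V k) (P₀ : H₀.Polarization)
    (g h : ℂ → Module.End ℂ (ℂ ⊗[ℚ] V)) (hgh : ∀ c ∈ ψ.target, ∀ w, g c (h c w) = w) (hhg : ∀ c ∈ ψ.target, ∀ w, h c (g c w) = w)
    (hh : ∀ (φ : Module.Dual ℂ (ℂ ⊗[ℚ] V)) (w : ℂ ⊗[ℚ] V), AnalyticOnNhd ℂ (fun c => φ (h c w)) ψ.target)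
    (hg1 : ∀ (w : ℂ ⊗[ℚ] V) (φ : (ℂ ⊗[ℚ] V) →ₗ[ℂ] ℂ), Tendsto (fun c => φ (g c w)) (𝓝 (ψ x)) (𝓝 (φ w)))
    (hF : ∀ c ∈ ψ.target, ∀ q : ℤ, ((D.hodge (ψ.symm c)).F q).map ((e c).toLinearMap.baseChange ℂ) = (H₀.F q).map (g c))
    (hQ : ∀ c ∈ ψ.target, ∀ x y : D.V.fiber (ψ.symm c), (D.form (ψ.symm c)).form x y = P₀.form (e c x) (e c y))
    (Λ : Submodule ℤ V) (hΛ : Λ.FG) (hΛ₁ : ∀ c ∈ ψ.target, ∀ u : D.VZ.fiber (ψ.symm c), e c (D.toRat (ψ.symm c) u) ∈ Λ)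
    (hΛ₂ : ∀ c ∈ ψ.target, ∀ v ∈ Λ, ∃ u : D.VZ.fiber (ψ.symm c), e c (D.toRat (ψ.symm c) u) = v) (K : ℤ) :
    D.hodgeLocusOfNormLe p K ∈ 𝓝 x ∨ ∀ᶠ y in 𝓝[≠] x, y ∉ D.hodgeLocusOfNormLe p K := by
  have hc₀ : ψ x ∈ ψ.target := ψ.map_source hx
  -- a coordinate ball around `ψ x` inside the target on which the Hodge metrics are uniformly comparable (`κ = 1/2`)
  have hev := D.eventually_hodgeNorm_fiber_mem_Icc_of_lift ψ.symm ψ.open_target hc₀ e H₀ P₀ g hg1 hF hQ (ε := 1 / 2) (by norm_num)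
  obtain ⟨r, hr, hball⟩ := Metric.mem_nhds_iff.1 hev
  set B : Set ℂ := Metric.ball (ψ x) r with hB
  have hBU : ∀ c ∈ B, c ∈ ψ.target := fun c hc => (hball hc).1
  have hnorm : ∀ c ∈ B, ∀ y : D.V.fiber (ψ.symm c), 1 / 2 * P₀.hodgeNorm (ofRat (e c y)) ≤ (D.form (ψ.symm c)).hodgeNorm (ofRat y) :=
    fun c hc y => by
      have h1 := ((hball hc).2 y).1
      norm_num at h1 ⊢
      linarith
  -- the interior-chart dichotomy on the ball
  have hdich := D.forall_mem_hodgeLocusOfNormLe_or_forall_eventually_not_mem_interior_chart hpk ψ.symm Metric.isOpen_ball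
    (convex_ball (ψ x) r).isPreconnected e H₀ P₀ h (fun φ w => (hh φ w).mono fun c hc => hBU c hc)
    (fun c hc => by rw [hF c (hBU c hc) p, comap_eq_map_of_inverse (H₀.F p) (hgh c (hBU c hc)) (hhg c (hBU c hc))])
    (fun c hc => hQ c (hBU c hc)) Λ hΛ (fun c hc => hΛ₁ c (hBU c hc)) (fun c hc => hΛ₂ c (hBU c hc)) (κ := 1 / 2) (by norm_num) hnorm K
  rcases hdich with hall | hiso
  · -- the chart pull-back of the ball is an open neighbourhood of `x` inside the locus
    refine Or.inl (Filter.mem_of_superset ((ψ.isOpen_inter_preimage Metric.isOpen_ball).mem_nhds ⟨hx, Metric.mem_ball_self hr⟩) ?_)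
    rintro y ⟨hy, hyB⟩
    have h := hall (ψ y) hyB
    rwa [ψ.left_inv hy] at h
  · refine Or.inr ?_
    filter_upwards [eventually_nhdsWithin_ne_of_chart' ψ hx (hiso (ψ x) (Metric.mem_ball_self hr))] with y ⟨hy, hPy⟩
    rwa [ψ.left_inv hy] at hPy

/-! ## §5 Theorem 1.1 (`r = 1`) with holomorphic-lift interior charts -/

/-- **Cattani–Deligne–Kaplan, THEOREM 1.1 / COROLLARY 1.2 over a ONE-DIMENSIONAL base for `D : VHSData S k` (`k = p + p`), the interior charts
given by HOLOMORPHIC LIFTS of the period map.**  `S` preconnected.  At every point `x`: a chart `ψ : OpenPartialHomeomorph S ℂ` with `x ∈ ψ.source`,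
a flat trivialization `e c : V_{ψ⁻¹(c)} ≃ V` over its target carrying every `F^q` to `g(c)·F₀^q` (`g`, `h = g⁻¹` endomorphisms of `V_ℂ`, `h`
weakly holomorphic on the target, `g(c) → 1` weakly at `ψ(x)`), `Q` to `Q₀` and `V_ℤ` ONTO a finitely generated `Λ₀`.  At the punctures
`i : ι`: the local period charts with unipotent monodromy of `VHSDataHodgeLocusNearPuncture` (`Lᵢ, Γᵢ, Λᵢ, σᵢ, eᵢ, A₀ᵢ`), open images
`σᵢ{Im z > A}`, and a compact core `C ∪ ⋃ᵢ σᵢ{Im z > Aᵢ} = S` for all heights.  Then **`hodgeLocusOfNormLe D p K` is ALL of `S` or a FINITE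
set** («`S^{(K)}` is an algebraic variety, finite over `S`», on a curve).
[cite: CattaniDeligneKaplan1995, Thm. 1.1, Cor. 1.2 (p. 484) and «Proof of 1.5 ⟹ 1.1» (p. 485)] [cite: CattaniKaplanSchmid1987, §3 proof of Cor. (3.7) (p. 22)]
[cite: Schmid1973, §3 and (4.12) (cite only)] -/
theorem hodgeLocusOfNormLe_eq_univ_or_finite_of_lift [PreconnectedSpace S] {p : ℤ} (hpk : p + p = k) (K : ℤ)
    -- holomorphic-lift interior charts at every point
    (hint : ∀ x : S, ∃ ψ : OpenPartialHomeomorph S ℂ, x ∈ ψ.source ∧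
      ∃ (e : ∀ c : ℂ, D.V.fiber (ψ.symm c) ≃ₗ[ℚ] V) (H₀ : HodgeStructure V k) (P₀ : H₀.Polarization) (g h : ℂ → Module.End ℂ (ℂ ⊗[ℚ] V))
        (Λ₀ : Submodule ℤ V),
        (∀ c ∈ ψ.target, ∀ w, g c (h c w) = w) ∧ (∀ c ∈ ψ.target, ∀ w, h c (g c w) = w) ∧
        (∀ (φ : Module.Dual ℂ (ℂ ⊗[ℚ] V)) (w : ℂ ⊗[ℚ] V), AnalyticOnNhd ℂ (fun c => φ (h c w)) ψ.target) ∧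
        (∀ (w : ℂ ⊗[ℚ] V) (φ : (ℂ ⊗[ℚ] V) →ₗ[ℂ] ℂ), Tendsto (fun c => φ (g c w)) (𝓝 (ψ x)) (𝓝 (φ w))) ∧
        (∀ c ∈ ψ.target, ∀ q : ℤ, ((D.hodge (ψ.symm c)).F q).map ((e c).toLinearMap.baseChange ℂ) = (H₀.F q).map (g c)) ∧
        (∀ c ∈ ψ.target, ∀ x y : D.V.fiber (ψ.symm c), (D.form (ψ.symm c)).form x y = P₀.form (e c x) (e c y)) ∧
        Λ₀.FG ∧ (∀ c ∈ ψ.target, ∀ u : D.VZ.fiber (ψ.symm c), e c (D.toRat (ψ.symm c) u) ∈ Λ₀) ∧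
        (∀ c ∈ ψ.target, ∀ v ∈ Λ₀, ∃ u : D.VZ.fiber (ψ.symm c), e c (D.toRat (ψ.symm c) u) = v))
    -- puncture charts
    {ι : Type*} (L : ι → PolarizedLimitMixedHodgeStructure V k) (Γ : ι → ℂ → Module.End ℂ (ℂ ⊗[ℚ] V)) (hΓ0 : ∀ i, Γ i 0 = 0)
    (hΓan : ∀ (i : ι) (φ : Module.Dual ℂ (ℂ ⊗[ℚ] V)) (w : ℂ ⊗[ℚ] V), AnalyticAt ℂ (fun s => φ (Γ i s w)) 0)
    (hΓb : ∀ (i : ι) (s : ℂ), Γ i s ∈ ⨆ ab ∈ {ab : ℤ × ℤ | ab.1 ≤ -1}, (L i).toMixedHodgeStructure.endPiece ab.1 ab.2)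
    (Λ : ι → Submodule ℤ V) (hΛ : ∀ i, (Λ i).FG) (hΛT : ∀ i, ∀ u ∈ Λ i, (L i).monodromy u ∈ Λ i)
    (σ : ι → ℂ → S) (e : ∀ (i : ι) (z : ℂ), D.V.fiber (σ i z) ≃ₗ[ℚ] V) (A₀ : ι → ℝ)
    (hF : ∀ (i : ι) (z : ℂ), A₀ i ≤ z.im → ((D.hodge (σ i z)).F p).map ((e i z).toLinearMap.baseChange ℂ) =
      (((L i).F p).map (IsNilpotent.exp (Γ i (Complex.exp (2 * Real.pi * Complex.I * z))))).map (IsNilpotent.exp (z • (L i).N.baseChange ℂ)))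
    (hQ : ∀ (i : ι) (z : ℂ), A₀ i ≤ z.im → ∀ x y : D.V.fiber (σ i z), (D.form (σ i z)).form x y = (L i).Q (e i z x) (e i z y))
    (hΛ₁ : ∀ (i : ι) (z : ℂ), A₀ i ≤ z.im → ∀ u : D.VZ.fiber (σ i z), e i z (D.toRat (σ i z) u) ∈ Λ i)
    (hΛ₂ : ∀ (i : ι) (z : ℂ), A₀ i ≤ z.im → ∀ v ∈ Λ i, ∃ u : D.VZ.fiber (σ i z), e i z (D.toRat (σ i z) u) = v)
    (hopen : ∀ (i : ι) (A : ℝ), A₀ i ≤ A → IsOpen (σ i '' {z : ℂ | A < z.im}))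
    (hcore : ∀ A : ι → ℝ, (∀ i, A₀ i ≤ A i) → ∃ C : Set S, IsCompact C ∧ C ∪ ⋃ i, σ i '' {z : ℂ | A i < z.im} = univ) :
    D.hodgeLocusOfNormLe p K = univ ∨ (D.hodgeLocusOfNormLe p K).Finite := by
  refine D.hodgeLocusOfNormLe_eq_univ_or_finite_of_local p K (fun x => ?_) σ A₀ hopen hcore fun i => ?_
  · obtain ⟨ψ, hx, e', H₀, P₀, g, h, Λ₀, hgh, hhg, hh, hg1, hF', hQ', hΛ₀, hΛ₁', hΛ₂'⟩ := hint x
    exact D.mem_nhds_or_eventually_not_mem_hodgeLocusOfNormLe_of_lift hpk ψ hx e' H₀ P₀ g h hgh hhg hh hg1 hF' hQ' Λ₀ hΛ₀ hΛ₁' hΛ₂' K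
  · obtain ⟨A, -, hA₀, hA⟩ := D.forall_mem_hodgeLocusOfNormLe_or_forall_not_mem (L i) hpk (Γ i) (hΓ0 i) (hΓan i) (hΓb i) (Λ i) (hΛ i)
      (hΛT i) (σ i) (e i) (A₀ i) (hF i) (hQ i) (hΛ₁ i) (hΛ₂ i) K
    exact ⟨A, hA₀, hA⟩

end Motives.VHSData

end Literature.AlgebraicGeometry

end
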